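import Summits.QuantumFields.YangMills.Theses.ScalingWindowSplit
import Summits.QuantumFields.YangMills.Theorems.GronwallGapContinuumFromLatticeGapOneFieldLocal
import Summits.QuantumFields.YangMills.Theorems.ScalingWindowSplitExistenceLegFromLatticeGapped

/-!
# RESTATE KIT for crux stmt-QuantumFields-18927 `ScalingWindowSplit.GapAtCorrelationLength` (W₁) — line lead gen 1, seat a1

The crux AS TYPED quantifies conjunct (b) (RP-spectral relative clustering of reflected time-slab functionals) over
the spatially GLOBAL slab class.  For admissible `G` with `π₁(G) ≠ 0` (`SO(3)`, landed `isCompactSimpleLieGroup_SO3`)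
that clause is physics-false ('t Hooft flux sectors of the torus transfer matrix are near-degenerate), and three
kernel-checked negative lemmas modulo a hypothesis record it (`Theorems/GapAtCorrelationLength/Negative/*`:
`…_false_of_LightFluxGroup`, `…_false_of_PersistentSlabCorrelation`; `…_false_without_nonabelian` for the ∀-side).
The summit `YangMills` asks the gap for LOCAL gauge-invariant species only, and the route's only consumer of (b), the
existence leg, already exists in the tree over the LOCAL class:
`Theorems.ContinuumFromLatticeGap.oneField_of_latticeInequalities_local` (landed, sorry-free).

This file certifies the repair C′ for the planner (everything below elaborates sorry-free against the tree):

* `GapAtCorrelationLengthLocal` — W₁ᴸ: the crux VERBATIM except that conjunct (b) ranges over slab functionals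
  supported in a spatial box of half-side `R` with `2(R+1) ≤ S₀` (one more binder `R : ℕ`, one more hypothesis,
  `DependsOn Y {slab ∧ ∀ i ≠ 0, |e.1 i| ≤ R}`) — character-identical to the hypothesis of the landed local seam;
* `gapAtCorrelationLengthLocal_of_gapAtCorrelationLength` — W₁ → W₁ᴸ (pure weakening: the local class is a subclass);
* `existenceLegFromLatticeGapped_local` — W₁ᴸ → W₂ᴳ → U_R → `CoincidenceRotationBootstrap.HypercubicLimit`, i.e. the
  route's typed split `ExistenceLegFromLatticeGapped` re-proved with W₁ᴸ in place of W₁ (one lemma name changes: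
  `oneField_of_latticeInequalities` ↦ `oneField_of_latticeInequalities_local`);
* `closes_local` — the route's deciding theorem with W₁ᴸ in place of W₁.

So `ledger route edit route-QuantumFields-ScalingWindowSplit --restate GapAtCorrelationLength --statement '<body of
GapAtCorrelationLengthLocal>'` keeps the route closed-modulo-items with no other item touched (U_R, W₂ᴳ,
CurvatureAmnesia, EuclideanUpgrade never read (b)); the flux witnesses of the negative lemmas miss C′ (a box with
`2(R+1) ≤ S₀ < 2S₀+1` wraps no 2-cycle of the torus, and an open-surface ℤ₂-flux is not an observable of a centre-free
group).  W₁ᴸ for simply-connected `G` is still Chatterjee's weak-coupling lattice mass-gap problem (open); nothing here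
claims progress on it.
-/

noncomputable section

open scoped BigOperators Topology
open MeasureTheory Filter Set Function
open Literature.MathematicalPhysics.QuantumLattice Literature.MathematicalPhysics.AQFT
open Literature.MathematicalPhysics.QuantumFieldTheory

namespace Summit.QuantumFields.YangMills.Cruxes.GapAtCorrelationLength.RestateKit

open Summit.QuantumFields.YangMills.Theses.ScalingWindowSplit
  (GapAtCorrelationLength SelfNormalisedMomentBoundsR SelfNormalisedSkewnessGapped CurvatureAmnesia EuclideanUpgrade)

/-- **W₁ᴸ — `GapAtCorrelationLength` with conjunct (b) over the LOCAL slab class** (the repaired statement C′):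
verbatim the typed crux except that the RP-spectral conjunct quantifies over bounded measurable `Y` depending on the
edges of the time slab `[1, T₀]` inside the spatial box `{|x_i| ≤ R, i = 1,2,3}` with `2(R+1) ≤ S₀` — exactly the
hypothesis shape of the landed `oneField_of_latticeInequalities_local`. [folklore] -/
def GapAtCorrelationLengthLocal : Prop :=
  open Literature.MathematicalPhysics.QuantumLattice Literature.MathematicalPhysics.AQFT Literature.MathematicalPhysics.QuantumFieldTheory in let E := EuclideanSpace ℝ (Fin 4); ∀ (G : Type) [Group G] [TopologicalSpace G] [IsTopologicalGroup G] [CompactSpace G], IsCompactSimpleLieGroup G → letI : MeasurableSpace G := borel G; haveI : BorelSpace G := ⟨rfl⟩; ∃ (r : LatticeRep G) (sch : SpeciesScheme (YMSpecies G)) (u : SchwartzMap E ℝ) (p : ℕ) (M Δ C : ℝ), let bare : SpeciesScheme (YMSpecies G) := { sch with c := fun _ _ => 1, m := fun _ _ => 0 }; let T : SchwartzMap E ℝ → ℕ → ℝ := fun w k => latticeSchwinger r.ρ bare (fun s => s.F) k (1 + 1) (fun _ => r.curvature) ![w, thetaTest 4 w] - latticeSchwinger r.ρ bare (fun s => s.F)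 k 1 (fun _ => r.curvature) ![w] * latticeSchwinger r.ρ bare (fun s => s.F) k 1 (fun _ => r.curvature) ![thetaTest 4 w]; sch.HasWeakCouplingLimit ∧ (∃ N : ℕ, 1 ≤ N ∧ ∀ᶠ k in Filter.atTop, (sch.a k)⁻¹ ≤ (sch.a k * (sch.L k : ℝ)) ^ N) ∧ 0 < Δ ∧ HasLatticeMassGap r sch Δ ∧ (∀ᶠ k in Filter.atTop, ∀ (S₀ T₀ n R : ℕ), sch.L k ≤ S₀ → 2 * (T₀ + n + 1) ≤ S₀ → 2 * (R + 1) ≤ S₀ → ∀ (Y : LGConfig 4 G → ℝ) (B : ℝ), Measurable Y → (∀ U, |Y U| ≤ B) → DependsOn Y {e : Literature.MathematicalPhysics.QuantumLattice.ZdEdge 4 | (1 ≤ e.1 0 ∧ e.1 0 + (if e.2 = 0 then 1 else 0) ≤ T₀) ∧ ∀ i : Fin 4, i ≠ 0 → |e.1 i| ≤ R} → |(∫ U, Y (torusLift (2 * S₀ + 1) (GaugeConfig.timeReflect U)) * Y (configShift (-Pi.single 0 (n : ℤ)) (torusLift (2 * S₀ + 1) U)) ∂(wilsonMeasure r.ρ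 (sch.β k) : Measure (GaugeConfig 4 (2 * S₀ + 1) G))) - (∫ U, Y (torusLift (2 * S₀ + 1) U) ∂(wilsonMeasure r.ρ (sch.β k) : Measure (GaugeConfig 4 (2 * S₀ + 1) G))) ^ 2| ≤ Real.exp (-(Δ * sch.a k * n)) * ((∫ U, Y (torusLift (2 * S₀ + 1) (GaugeConfig.timeReflect U)) * Y (torusLift (2 * S₀ + 1) U) ∂(wilsonMeasure r.ρ (sch.β k) : Measure (GaugeConfig 4 (2 * S₀ + 1) G))) - (∫ U, Y (torusLift (2 * S₀ + 1) U) ∂(wilsonMeasure r.ρ (sch.β k) : Measure (GaugeConfig 4 (2 * S₀ + 1) G))) ^ 2) + C * B ^ 2 * Real.exp (-(Δ * sch.a k * S₀))) ∧ tsupport u ⊆ {y : E | y 0 < 0} ∧ ∀ᶠ k in Filter.atTop, (sch.a k) ^ p ≤ T u k ∧ T u k ≤ M * T (timeShiftTest 4 (-1) u) k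

/-- **W₁ → W₁ᴸ**: the typed crux implies its local form (the local class is contained in the slab class, so the
typed conjunct (b) specialises; every other conjunct is untouched). [folklore] -/
theorem gapAtCorrelationLengthLocal_of_gapAtCorrelationLength (h : GapAtCorrelationLength) :
    GapAtCorrelationLengthLocal := by
  intro G _ _ _ _ hG
  letI : MeasurableSpace G := borel G
  haveI : BorelSpace G := ⟨rfl⟩
  obtain ⟨r, sch, u, p, M, Δ, C, hw, hpv, hΔ, hgap, hrp, hu, hfw⟩ := h G hG
  refine ⟨r, sch, u, p, M, Δ, C, hw, hpv, hΔ, hgap, ?_, hu, hfw⟩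
  filter_upwards [hrp] with k hk S₀ T₀ n R hL h2 _hR Y B hYm hYb hYdep
  exact hk S₀ T₀ n hL h2 Y B hYm hYb (hYdep.mono fun e he => he.1)

/-- **The route's typed split with W₁ᴸ in place of W₁**: `W₁ᴸ → W₂ᴳ → U_R → HypercubicLimit` — literally the landed
`existenceLegFromLatticeGapped_proof` with the seam `oneField_of_latticeInequalities` replaced by the landed LOCAL
seam `ContinuumFromLatticeGap.oneField_of_latticeInequalities_local`. [cite: GlimmJaffe1987, §6.1 and §19.1] -/
theorem existenceLegFromLatticeGapped_local (hW : GapAtCorrelationLengthLocal) (hS : SelfNormalisedSkewnessGapped)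
    (hU : SelfNormalisedMomentBoundsR) :
    Summit.QuantumFields.YangMills.Theses.CoincidenceRotationBootstrap.HypercubicLimit := by
  refine Summit.QuantumFields.YangMills.Theorems.HypercubicLimit.OneFieldWeak.hypercubicLimit_iff_oneFieldWeak.mpr
    fun G _ _ _ _ hG => ?_
  letI : MeasurableSpace G := borel G
  haveI : BorelSpace G := ⟨rfl⟩
  obtain ⟨r, sch, u, p, M, Δ, C, hw, hpv, hΔ, hgap, hrp, hu, hfw⟩ := hW G hG
  obtain ⟨sch', S₁, hw', h₁⟩ :=
    Summit.QuantumFields.YangMills.Theorems.ContinuumFromLatticeGap.oneField_of_latticeInequalities_local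
      r sch u p M Δ C hw hpv hΔ hgap hrp hu hfw
      (hU G r sch u p M hw hpv hu hfw) (hS G r sch u p M Δ hw hΔ hgap hpv hu hfw)
  exact ⟨r, sch', S₁, hw', h₁⟩

/-- **The route's deciding theorem with W₁ᴸ in place of W₁** (`ScalingWindowSplit.closes` re-threaded through
`existenceLegFromLatticeGapped_local`; the binder `ExistenceLegFromLatticeGapped` of `closes` becomes a theorem).
[folklore] -/
theorem closes_local (hW : GapAtCorrelationLengthLocal) (hU : SelfNormalisedMomentBoundsR) (hA : CurvatureAmnesia)
    (hS : SelfNormalisedSkewnessGapped) (hUpg : EuclideanUpgrade) : YangMills :=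
  Summit.QuantumFields.YangMills.Theses.CoincidenceRotationBootstrap.closes hA
    (existenceLegFromLatticeGapped_local hW hS hU) hUpg

end Summit.QuantumFields.YangMills.Cruxes.GapAtCorrelationLength.RestateKit

end
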